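import Summits.Ventures.Crystal3D.Theorems.StickyWulffConstantNoReconstructionGainExactPrep
import Summits.Ventures.Crystal3D.Theorems.StickyWulffConstantCoaxialWallLawFrame
import Summits.Ventures.Crystal3D.Theorems.StickyWulffConstantNoReconstructionGainExactLevelSample
import Summits.Ventures.Crystal3D.Theorems.StickyWulffConstantNoReconstructionGainExactFilmAboveCutAll
import Summits.Ventures.Crystal3D.Theorems.StickyWulffConstantNoReconstructionGainThirdLatticeAll
import Summits.Ventures.Crystal3D.Theorems.StickyWulffConstantNoReconstructionGainSampleDeficit
import HarnessLib

/-!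
# Class-wise replication: an adhesion atom on a lattice-invariant class forbids criminals in that class;
# hence NO CRIMINAL INSIDE THE THIRD LATTICE (line `replication-exactness`)

HONEST FRAMING. Part of the venture `Summits/Ventures/Crystal3D` (cell `crystal3d-full`), supports the
crux `NoReconstructionGain` (stmt-Ventures-19144, route `route-Ventures-StickyWulffConstant`), line
`replication-exactness` (lead wulff-p1 g18).  The landed licence `stub_replication` (the crux ⇒ EXACT₀)
replicates ONE gaining film `≍ ρ²` times by flat lattice translations on a thickened lattice body.  The
same construction works CLASS-WISE: if the adhesion atom `#cross(P, X∖P) ≤ D(X∖P) + Cρ` is known for all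
packings around the slab sample whose film lies in a class `S ⊇ Λ₀` of positions invariant under
`Λ₀`-translations and strictly above the sample's top level, then no film inside `S` is a criminal — on
ANY face, with NO error term.  What makes the bookkeeping exact is `IsFilmOn.lt_inner`
(`…ExactFilmAboveCutAll`: every film ball lies strictly above its cut), so the copies stay strictly above
the sample; the body is thickened UPWARD only (its extra balls are lattice film balls above the sample),
and the sample's own deficiency enters through `stub_sampleDeficit` (lower bound) and
`latticeBody_deficit_le_unif` (upper bound for the thickened body).

* `not_isCriminal_of_classAtom` — the class-wise licence;
* `thirdLattice_add_fcc_mem` — `(1/3)Λ₀` is invariant under `Λ₀`-translations, `fcc_mem_thirdLattice` —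
  `Λ₀ ⊆ (1/3)Λ₀`;
* `not_isCriminal_of_subset_thirdLattice` — **EXACT₀ ON THE THIRD LATTICE: no film contained in
  `(1/3)Λ₀` (every mixture of fcc continuation, twin lamellae, stacking faults, hcp/dhcp islands on all
  four `{111}` families at once) is a criminal on any rigid half-crystal face `H(ν,s)`** — the exact,
  radius-free form of the g9 rung `thirdLatticeFilm_slab` (p601422, atom with `C = 18432`).

WHAT THIS IS NOT: the crux — criminals off the third lattice (rotated grains, amorphous films) are the
open class; rung F-C1 not moved.
-/

noncomputable section

namespace Summit.Ventures.Crystal3D.Theorems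

open Summit.Ventures.Crystal3D
open Literature.MathematicalPhysics.StatisticalMechanics (fccStacking barlowStacking barlowPos constHagg
  haggLabel_const barlowPos_apply_zero barlowPos_apply_one barlowPos_apply_two isHaggSeq_const
  le_dist_of_mem_barlowStacking_ideal contactDeficiency orderedContacts)
open scoped InnerProductSpace
open Finset

/-- **Class-wise replication licence.**  Let `S ⊇ Λ₀` be invariant under translations by `Λ₀`, and
suppose the adhesion atom holds (constants `R ≥ 1`, `C`) for every unit packing around the slab sample
`P_ρ(ν,R)` whose film balls lie in `S` and strictly above the level `−R`.  Then no film contained in `S`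
is a criminal, on any face. -/
theorem not_isCriminal_of_classAtom {S : Set (EuclideanSpace ℝ (Fin 3))}
    (hS : ∀ q ∈ S, ∀ t ∈ fccStacking 1 (Real.sqrt (2 / 3)), q + t ∈ S)
    (hΛS : fccStacking 1 (Real.sqrt (2 / 3)) ⊆ S)
    {R C : ℝ} (hR : 1 ≤ R)
    (hatom : ∀ ν : EuclideanSpace ℝ (Fin 3), ‖ν‖ = 1 → ∀ ρ : ℝ, R ≤ ρ →
      ∀ X P : Finset (EuclideanSpace ℝ (Fin 3)),
      (∀ p ∈ X, ∀ q ∈ X, p ≠ q → 1 ≤ dist p q) → P ⊆ X →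
      (∀ p, p ∈ P ↔ (p ∈ fccStacking 1 (Real.sqrt (2 / 3)) ∧ -(2 * R) ≤ ⟪p, ν⟫_ℝ ∧
        ⟪p, ν⟫_ℝ ≤ -R ∧ ‖p‖ ^ 2 - ⟪p, ν⟫_ℝ ^ 2 ≤ ρ ^ 2)) →
      (∀ q ∈ X \ P, q ∈ S) → (∀ q ∈ X \ P, -R < ⟪q, ν⟫_ℝ) →
      ((((P ×ˢ (X \ P)).filter fun pq => dist pq.1 pq.2 = 1).card : ℕ) : ℝ) ≤
        contactDeficiency (X \ P) + C * ρ)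
    {ν : EuclideanSpace ℝ (Fin 3)} (hν : ‖ν‖ = 1) {s : ℝ} {Q : Finset (EuclideanSpace ℝ (Fin 3))}
    (hQS : ∀ q ∈ Q, q ∈ S) : ¬ IsCriminal ν s Q := by
  classical
  intro hcrim
  obtain ⟨hQ, hne, hcore⟩ := hcrim
  -- (1) the gain and the film's constants
  have hgain : contactDeficiency Q < plugCount ν s Q := by
    have h1 := hcore Q (Finset.Subset.refl Q) hne
    simp only [Finset.sdiff_self, Finset.empty_product, Finset.filter_empty, Finset.card_empty,
      Nat.cast_zero, add_zero] at h1
    exact h1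
  have hint := contactDeficiency_add_one_le_plugCount hgain
  obtain ⟨δ, hδ, hδ1, hslack⟩ := exists_film_slack ν s Q
  set Dq : ℝ := ∑ q ∈ Q, ‖q‖ with hDq
  have hDq0 : 0 ≤ Dq := Finset.sum_nonneg fun q _ => norm_nonneg q
  have hqDq : ∀ q ∈ Q, ‖q‖ ≤ Dq := fun q hq =>
    Finset.single_le_sum (f := fun q => ‖q‖) (fun q _ => norm_nonneg q) hq
  obtain ⟨m, hm⟩ : ∃ m : ℕ, m = ⌈2 * Dq + 2⌉₊ + 1 := ⟨_, rfl⟩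
  have hm1 : 1 ≤ m := by rw [hm]; exact Nat.le_add_left 1 _
  have hmR : 2 * Dq + 2 ≤ (m : ℝ) := by
    rw [hm]; push_cast; linarith [Nat.le_ceil (2 * Dq + 2)]
  have hm0 : (0 : ℝ) ≤ m := Nat.cast_nonneg m
  -- (2) flat translations with height window `δ / 2`
  obtain ⟨c, hc, ρ₀, hρ₀, hflat⟩ :=
    exists_flatTranslations ν hν (δ / 2) (by linarith only [hδ]) (by linarith only [hδ1]) m hm1
  -- (3) vertical offset
  obtain ⟨t₀, ht₀Λ, ht₀lo, ht₀hi⟩ := exists_fcc_height_mem_Icc hν (-R + m + 2 - s)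
  -- (4) the constants: sample lower bound, body upper bound
  obtain ⟨CP, hCP⟩ := stub_sampleDeficit R hR
  obtain ⟨CU, hCU⟩ := latticeBody_deficit_le_unif
  set Tmax : ℝ := 3 * R + 2 * m + 6 with hTmax
  set CL : ℝ := |CU| * (1 + Tmax) with hCLdef
  have hCL0 : 0 ≤ CL := mul_nonneg (abs_nonneg _) (by rw [hTmax]; linarith only [hR, hm0])
  -- (5) the radius
  set ρ' : ℝ := max (max R (2 * ρ₀)) (max Tmax (max (2 * (Dq + ‖t₀‖ + 2))
    (4 * (|C| + CL + |CP|) / c + 1))) with hρ'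
  have hρ'R : R ≤ ρ' := le_max_of_le_left (le_max_left _ _)
  have hρ'ρ₀ : ρ₀ ≤ ρ' / 2 := by
    have : 2 * ρ₀ ≤ ρ' := le_max_of_le_left (le_max_right _ _); linarith only [this]
  have hρ'T : Tmax ≤ ρ' := le_max_of_le_right (le_max_left _ _)
  have hρ'lat : Dq + ‖t₀‖ + 2 ≤ ρ' / 2 := by
    have : 2 * (Dq + ‖t₀‖ + 2) ≤ ρ' := le_max_of_le_right (le_max_of_le_right (le_max_left _ _))
    linarith only [this]
  have hρ'c : 4 * (|C| + CL + |CP|) / c + 1 ≤ ρ' :=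
    le_max_of_le_right (le_max_of_le_right (le_max_right _ _))
  have hρ'pos : 0 < ρ' := lt_of_lt_of_le (by linarith only [hR]) hρ'R
  obtain ⟨T, hTΛ, hTnorm, hTsep, ⟨a, ha, hwin⟩, hTcard⟩ := hflat (ρ' / 2) hρ'ρ₀
  -- (6) the cut and the upward-thickened lattice body
  set s' : ℝ := s + ⟪t₀, ν⟫_ℝ + a + δ / 2 with hs'
  rw [abs_le] at ha
  have hs'lo : -R + δ / 2 ≤ s' := by rw [hs']; linarith only [ht₀lo, ha.1]
  have hs'lo' : -R ≤ s' := by linarith only [hs'lo, hδ]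
  have hs'hi : s' ≤ -R + 2 * m + 6 := by rw [hs']; linarith only [ht₀hi, ha.2, hδ1]
  obtain ⟨L, hL⟩ := exists_latticeBody ν (-(2 * R)) s' ρ'
  set P := L.filter fun z => ⟪z, ν⟫_ℝ ≤ -R with hPdef
  have hP : ∀ p, p ∈ P ↔ (p ∈ fccStacking 1 (Real.sqrt (2 / 3)) ∧ -(2 * R) ≤ ⟪p, ν⟫_ℝ ∧
      ⟪p, ν⟫_ℝ ≤ -R ∧ ‖p‖ ^ 2 - ⟪p, ν⟫_ℝ ^ 2 ≤ ρ' ^ 2) := by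
    intro p
    rw [hPdef, Finset.mem_filter, hL]
    constructor
    · rintro ⟨⟨h1, h2, -, h4⟩, h5⟩; exact ⟨h1, h2, h5, h4⟩
    · rintro ⟨h1, h2, h3, h4⟩; exact ⟨⟨h1, h2, by linarith only [h3, hs'lo'], h4⟩, h3⟩
  have hPL : P ⊆ L := Finset.filter_subset _ _
  -- (7) the copies
  set G : EuclideanSpace ℝ (Fin 3) → Finset (EuclideanSpace ℝ (Fin 3)) :=
    fun t => Q.image fun q => q + (t₀ + t) with hG
  set F := T.biUnion G with hF
  have hτΛ : ∀ t ∈ T, t₀ + t ∈ fccStacking 1 (Real.sqrt (2 / 3)) :=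
    fun t ht => fcc_add_site_mem ht₀Λ (hTΛ t ht)
  have hcut : ∀ t ∈ T, s' - δ / 2 ≤ s + ⟪t₀ + t, ν⟫_ℝ ∧ s + ⟪t₀ + t, ν⟫_ℝ < s' := by
    intro t ht
    obtain ⟨hw1, hw2⟩ := hwin t ht
    rw [inner_add_left, hs']
    constructor <;> linarith only [hw1, hw2]
  have hfilm : ∀ t ∈ T, IsFilmOn ν (s + ⟪t₀ + t, ν⟫_ℝ) (G t) :=
    fun t ht => isFilmOn_translate (hτΛ t ht) hQ
  have hpc : ∀ t ∈ T, plugCount ν (s + ⟪t₀ + t, ν⟫_ℝ) (G t) = plugCount ν s Q :=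
    fun t ht => plugCount_translate (hτΛ t ht) s Q
  have hDG : ∀ t, contactDeficiency (G t) = contactDeficiency Q :=
    fun t => contactDeficiency_translate _ Q
  have hGmem : ∀ t y, y ∈ G t ↔ ∃ q ∈ Q, y = q + (t₀ + t) := by
    intro t y
    rw [hG, Finset.mem_image]
    constructor
    · rintro ⟨q, hq, rfl⟩; exact ⟨q, hq, rfl⟩
    · rintro ⟨q, hq, rfl⟩; exact ⟨q, hq, rfl⟩
  have hGnorm : ∀ t ∈ T, ∀ y ∈ G t, ‖y‖ ≤ Dq + ‖t₀‖ + ρ' / 2 := by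
    intro t ht y hy
    obtain ⟨q, hq, rfl⟩ := (hGmem t y).1 hy
    calc ‖q + (t₀ + t)‖ ≤ ‖q‖ + ‖t₀ + t‖ := norm_add_le _ _
      _ ≤ ‖q‖ + (‖t₀‖ + ‖t‖) := add_le_add le_rfl (norm_add_le _ _)
      _ ≤ Dq + (‖t₀‖ + ρ' / 2) := add_le_add (hqDq q hq) (add_le_add le_rfl (hTnorm t ht))
      _ = Dq + ‖t₀‖ + ρ' / 2 := by ring
  -- film balls lie strictly above their cut, hence strictly above `−R`
  have hGheight : ∀ t ∈ T, ∀ y ∈ G t, -R < ⟪y, ν⟫_ℝ := by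
    intro t ht y hy
    have h1 := IsFilmOn.lt_inner hν (hfilm t ht) hy
    linarith only [h1, (hcut t ht).1, hs'lo, hδ]
  have hGS : ∀ t ∈ T, ∀ y ∈ G t, y ∈ S := by
    intro t ht y hy
    obtain ⟨q, hq, rfl⟩ := (hGmem t y).1 hy
    exact hS q (hQS q hq) _ (hτΛ t ht)
  -- (8) distances
  have hfarGG : ∀ t ∈ T, ∀ t' ∈ T, t ≠ t' → ∀ y ∈ G t, ∀ y' ∈ G t', 1 < dist y y' := by
    intro t ht t' ht' hne y hy y' hy'
    obtain ⟨q, hq, rfl⟩ := (hGmem t y).1 hy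
    obtain ⟨q', hq', rfl⟩ := (hGmem t' y').1 hy'
    have hsep := hTsep t ht t' ht' hne
    rw [dist_eq_norm] at hsep ⊢
    have e : q + (t₀ + t) - (q' + (t₀ + t')) = (t - t') + (q - q') := by abel
    rw [e]
    have h1 : ‖t - t'‖ - ‖q - q'‖ ≤ ‖(t - t') + (q - q')‖ := by
      have h3 := norm_sub_norm_le (t - t') (-(q - q'))
      rwa [norm_neg, sub_neg_eq_add] at h3
    have h2 : ‖q - q'‖ ≤ 2 * Dq := by
      calc ‖q - q'‖ ≤ ‖q‖ + ‖q'‖ := norm_sub_le _ _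
        _ ≤ Dq + Dq := add_le_add (hqDq q hq) (hqDq q' hq')
        _ = 2 * Dq := by ring
    linarith only [hsep, h1, h2, hmR]
  have hdisjGG : ∀ t ∈ T, ∀ t' ∈ T, t ≠ t' → Disjoint (G t) (G t') := by
    intro t ht t' ht' hne
    rw [Finset.disjoint_left]
    intro y hy hy'
    have := hfarGG t ht t' ht' hne y hy y hy'
    rw [dist_self] at this; linarith only [this]
  have hLG : ∀ z ∈ L, ∀ t ∈ T, ∀ y ∈ G t, 1 ≤ dist z y := by
    intro z hz t ht y hy
    obtain ⟨hzΛ, -, hzhi, -⟩ := (hL z).1 hz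
    by_cases hzc : ⟪z, ν⟫_ℝ ≤ s + ⟪t₀ + t, ν⟫_ℝ
    · rw [dist_comm]; exact (hfilm t ht).2 y hy z ⟨hzΛ, hzc⟩
    · push Not at hzc
      obtain ⟨q, hq, rfl⟩ := (hGmem t y).1 hy
      have hz' : z - (t₀ + t) ∈ fccStacking 1 (Real.sqrt (2 / 3)) := fcc_sub_site_mem hzΛ (hτΛ t ht)
      have h1 : s < ⟪z - (t₀ + t), ν⟫_ℝ := by rw [inner_sub_left]; linarith only [hzc]
      have h2 : ⟪z - (t₀ + t), ν⟫_ℝ ≤ s + δ := by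
        rw [inner_sub_left]; linarith only [hzhi, (hcut t ht).1, hδ]
      have h3 := hslack _ hz' h1 h2 q hq
      have e : dist (q + (t₀ + t)) z = dist q (z - (t₀ + t)) := by
        rw [dist_eq_norm, dist_eq_norm]; congr 1; abel
      rw [dist_comm, e]; exact h3
  have hLL : ∀ z ∈ L, ∀ z' ∈ L, z ≠ z' → 1 ≤ dist z z' := fun z hz z' hz' hne =>
    le_dist_of_mem_barlowStacking_ideal isHaggSeq_const one_pos fcc_height_sq ((hL z).1 hz).1
      ((hL z').1 hz').1 hne
  have hFmem : ∀ y, y ∈ F ↔ ∃ t ∈ T, y ∈ G t := by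
    intro y; rw [hF, Finset.mem_biUnion]
  set X := L ∪ F with hX
  have hXpack : ∀ p ∈ X, ∀ q ∈ X, p ≠ q → 1 ≤ dist p q := by
    intro p hp q hq hne
    rw [hX, Finset.mem_union] at hp hq
    rcases hp with hp | hp <;> rcases hq with hq | hq
    · exact hLL p hp q hq hne
    · obtain ⟨t, ht, hqt⟩ := (hFmem q).1 hq
      exact hLG p hp t ht q hqt
    · obtain ⟨t, ht, hpt⟩ := (hFmem p).1 hp
      rw [dist_comm]; exact hLG q hq t ht p hpt
    · obtain ⟨t, ht, hpt⟩ := (hFmem p).1 hp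
      obtain ⟨t', ht', hqt⟩ := (hFmem q).1 hq
      by_cases htt : t = t'
      · subst htt
        exact (hfilm t ht).1 p hpt q hqt hne
      · exact (hfarGG t ht t' ht' htt p hpt q hqt).le
  have hLFdisj : Disjoint L F := by
    rw [Finset.disjoint_left]
    intro z hz hzF
    obtain ⟨t, ht, hzt⟩ := (hFmem z).1 hzF
    have := hLG z hz t ht z hzt
    rw [dist_self] at this; linarith only [this]
  have hXL : X \ L = F := by rw [hX, Finset.union_sdiff_cancel_left hLFdisj]
  have hPX : P ⊆ X := hPL.trans (by rw [hX]; exact Finset.subset_union_left)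
  -- the film of the atom: `X \ P = (L \ P) ∪ F`
  have hfilmX : ∀ q ∈ X \ P, (q ∈ L ∧ -R < ⟪q, ν⟫_ℝ) ∨ q ∈ F := by
    intro q hq
    rw [Finset.mem_sdiff, hX, Finset.mem_union] at hq
    rcases hq.1 with h | h
    · left
      refine ⟨h, ?_⟩
      by_contra hle
      push Not at hle
      exact hq.2 (by rw [hPdef, Finset.mem_filter]; exact ⟨h, hle⟩)
    · exact Or.inr h
  have hXS : ∀ q ∈ X \ P, q ∈ S := by
    intro q hq
    rcases hfilmX q hq with ⟨hqL, -⟩ | hqF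
    · exact hΛS ((hL q).1 hqL).1
    · obtain ⟨t, ht, hqt⟩ := (hFmem q).1 hqF
      exact hGS t ht q hqt
  have hXabove : ∀ q ∈ X \ P, -R < ⟪q, ν⟫_ℝ := by
    intro q hq
    rcases hfilmX q hq with ⟨-, h⟩ | hqF
    · exact h
    · obtain ⟨t, ht, hqt⟩ := (hFmem q).1 hqF
      exact hGheight t ht q hqt
  -- (9) the atom
  have hA := hatom ν hν ρ' hρ'R X P hXpack hPX hP hXS hXabove
  -- (10) deficiency identities
  have hD1 := contactDeficiency_sdiff_split hPX
  have hD2 := contactDeficiency_sdiff_split (X := X) (P := L) (by rw [hX]; exact Finset.subset_union_left)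
  rw [hXL] at hD2
  have hDF : contactDeficiency F = T.card * contactDeficiency Q := by
    rw [hF, contactDeficiency_biUnion_of_far T G hfarGG]
    simp only [hDG, Finset.sum_const, nsmul_eq_mul]
  have hcross : (T.card : ℝ) * plugCount ν s Q ≤
      ((((L ×ˢ F).filter fun pq => dist pq.1 pq.2 = 1).card : ℕ) : ℝ) := by
    rw [hF, card_cross_biUnion L T G hdisjGG]
    push_cast
    have : ∀ t ∈ T, (plugCount ν s Q : ℝ) ≤
        ((((L ×ˢ G t).filter fun pq => dist pq.1 pq.2 = 1).card : ℕ) : ℝ) := by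
      intro t ht
      rw [← hpc t ht, card_cross_eq_sum, plugCount]
      push_cast
      refine Finset.sum_le_sum fun y hy => ?_
      -- every plug site of the copy lies in the body
      have hsub : ∀ z ∈ plugSet ν (s + ⟪t₀ + t, ν⟫_ℝ) y, z ∈ L := by
        intro z hz
        obtain ⟨⟨hzΛ, hzc⟩, hzd⟩ := hz
        have hyh := hGheight t ht y hy
        have hyn := hGnorm t ht y hy
        have hzh : ⟪y, ν⟫_ℝ - 1 ≤ ⟪z, ν⟫_ℝ := by
          have := (le_abs_self _).trans (abs_inner_sub_le_dist hν y z)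
          rw [hzd] at this; linarith only [this]
        refine (hL z).2 ⟨hzΛ, by linarith only [hzh, hyh, hR], by linarith only [hzc, (hcut t ht).2], ?_⟩
        have hz1 : ‖z‖ ≤ ‖y‖ + 1 := by
          have := norm_sub_norm_le z y
          rw [← dist_eq_norm, dist_comm, hzd] at this; linarith only [this]
        have hz2 : ‖z‖ ≤ ρ' := by linarith only [hz1, hyn, hρ'lat]
        have hzz : ‖z‖ ^ 2 ≤ ρ' ^ 2 := by
          rw [pow_two, pow_two]; exact mul_le_mul hz2 hz2 (norm_nonneg z) hρ'pos.le
        linarith only [hzz, sq_nonneg ⟪z, ν⟫_ℝ]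
      exact_mod_cast plugSet_ncard_le_card_filter ν _ L y hsub
    calc (T.card : ℝ) * plugCount ν s Q = ∑ t ∈ T, (plugCount ν s Q : ℝ) := by
          rw [Finset.sum_const, nsmul_eq_mul]
      _ ≤ _ := Finset.sum_le_sum this
  -- (11) the sample and body estimates
  have hDP := hCP ν hν ρ' hρ'R P hP
  have hTval : s' - -(2 * R) = s' + 2 * R := by ring
  have hT1 : 1 ≤ s' + 2 * R := by linarith only [hs'lo', hR]
  have hTle : s' + 2 * R ≤ Tmax := by rw [hTmax]; linarith only [hs'hi, hR]
  have hDL := hCU ν hν (s' + 2 * R) hT1 (-(2 * R)) s' hTval ρ' (le_trans hTle hρ'T) L hL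
  have hDL' : contactDeficiency L ≤
      2 * (Real.sqrt 2 / 4 * ∑ᶠ w ∈ {w ∈ fccStacking 1 (Real.sqrt (2 / 3)) | ‖w‖ = 1},
        |⟪w, ν⟫_ℝ|) * Real.pi * ρ' ^ 2 + CL * ρ' := by
    have h1 : CU * (1 + (s' + 2 * R)) * ρ' ≤ CL * ρ' := by
      rw [hCLdef]
      refine mul_le_mul_of_nonneg_right ?_ hρ'pos.le
      calc CU * (1 + (s' + 2 * R)) ≤ |CU| * (1 + (s' + 2 * R)) :=
            mul_le_mul_of_nonneg_right (le_abs_self _) (by linarith only [hT1])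
        _ ≤ |CU| * (1 + Tmax) := mul_le_mul_of_nonneg_left (by linarith only [hTle]) (abs_nonneg _)
    linarith only [hDL, h1]
  -- (12) counting: `c ρ'²/4 ≤ #T ≤ (C + CL + CP) ρ'`
  have hM : c * (ρ' / 2) ^ 2 ≤ T.card := hTcard
  have hprod : (T.card : ℝ) * (contactDeficiency Q + 1) ≤ (T.card : ℝ) * plugCount ν s Q :=
    mul_le_mul_of_nonneg_left hint (Nat.cast_nonneg _)
  have hkey : (T.card : ℝ) ≤ (C + CL + CP) * ρ' := by
    -- atom: cross(P, X∖P) ≤ D(X∖P) + Cρ'; identities: cross(L,F) ≤ D(L) − D(P) + D(F) + Cρ'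
    linarith only [hA, hD1, hD2, hDF, hcross, hDP, hDL', hprod]
  have h2 : (C + CL + CP) * ρ' ≤ (|C| + CL + |CP|) * ρ' :=
    mul_le_mul_of_nonneg_right (by linarith only [le_abs_self C, le_abs_self CP]) hρ'pos.le
  have h3 : c * ρ' / 4 ≤ |C| + CL + |CP| := by
    have : c * (ρ' / 2) ^ 2 = (c * ρ' / 4) * ρ' := by ring
    rw [this] at hM
    exact le_of_mul_le_mul_right (hM.trans (hkey.trans h2)) hρ'pos
  have h4 : ρ' ≤ 4 * (|C| + CL + |CP|) / c := by
    rw [le_div_iff₀ hc]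
    calc ρ' * c = 4 * (c * ρ' / 4) := by ring
      _ ≤ 4 * (|C| + CL + |CP|) := mul_le_mul_of_nonneg_left h3 (by norm_num)
  exact not_le.2 (lt_add_one (4 * (|C| + CL + |CP|) / c)) (hρ'c.trans h4)

/-! ## The third lattice -/

/-- `(1/3)Λ₀` is invariant under translations by `Λ₀`. -/
theorem thirdLattice_add_fcc_mem {q t : EuclideanSpace ℝ (Fin 3)}
    (hq : ∃ K I J : ℤ, q = (1 / 3 : ℝ) • barlowPos 1 (Real.sqrt (2 / 3)) constHagg K I J)
    (ht : t ∈ fccStacking 1 (Real.sqrt (2 / 3))) :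
    ∃ K I J : ℤ, q + t = (1 / 3 : ℝ) • barlowPos 1 (Real.sqrt (2 / 3)) constHagg K I J := by
  obtain ⟨K, I, J, rfl⟩ := hq
  obtain ⟨k, i, j, rfl⟩ := ht
  refine ⟨K + 3 * k, I + 3 * i, J + 3 * j, ?_⟩
  ext l
  fin_cases l <;>
    simp [barlowPos_apply_zero, barlowPos_apply_one, barlowPos_apply_two, haggLabel_const] <;> ring

/-- `Λ₀ ⊆ (1/3)Λ₀`. -/
theorem fcc_mem_thirdLattice {p : EuclideanSpace ℝ (Fin 3)} (hp : p ∈ fccStacking 1 (Real.sqrt (2 / 3))) :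
    ∃ K I J : ℤ, p = (1 / 3 : ℝ) • barlowPos 1 (Real.sqrt (2 / 3)) constHagg K I J := by
  obtain ⟨k, i, j, rfl⟩ := hp
  refine ⟨3 * k, 3 * i, 3 * j, ?_⟩
  ext l
  fin_cases l <;>
    simp [barlowPos_apply_zero, barlowPos_apply_one, barlowPos_apply_two, haggLabel_const] <;> ring

/-- **EXACT₀ on the third lattice: no film contained in `(1/3)Λ₀` is a criminal**, on any rigid
half-crystal face — the exact form of the rung `thirdLatticeFilm_slab`. -/
theorem not_isCriminal_of_subset_thirdLattice {ν : EuclideanSpace ℝ (Fin 3)} (hν : ‖ν‖ = 1) {s : ℝ}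
    {Q : Finset (EuclideanSpace ℝ (Fin 3))}
    (hQ : ∀ q ∈ Q, ∃ K I J : ℤ, q = (1 / 3 : ℝ) • barlowPos 1 (Real.sqrt (2 / 3)) constHagg K I J) :
    ¬ IsCriminal ν s Q := by
  obtain ⟨R, C, hR, hatom⟩ := thirdLatticeFilm_slab
  exact not_isCriminal_of_classAtom
    (S := {q | ∃ K I J : ℤ, q = (1 / 3 : ℝ) • barlowPos 1 (Real.sqrt (2 / 3)) constHagg K I J})
    (fun q hq t ht => thirdLattice_add_fcc_mem hq ht) (fun p hp => fcc_mem_thirdLattice hp) hR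
    (fun ν hν ρ hρ X P hX hPX hP hS habove => hatom ν hν ρ hρ X P hX hPX hP hS habove) hν hQ

end Summit.Ventures.Crystal3D.Theorems

end
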